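import Summits.QuantumFields.YangMills.Theorems.BalabanUVNodesN07RadialAxialTower
import Summits.QuantumFields.YangMills.Theorems.BalabanUVNodesN07SplitClauseHeadKnitMeetNormalised
import HarnessLib

/-!
# N07 [B11] (= [15] = [Balaban1985Variational]) Sect. F — **THE NORMALISATION OF RECORD** `NrmOfRecord`: print's «restrictions `ū_j = 1` on `Λ′_j`» (p. 301, the sentence before
# (152)) as the CONCRETE `Nrm` text plugged into MODULE 59's normalised meet knit, in the tree's own letters ([3] (78)–(81): `R̄ʲu = gaugeAvgIter …`), with (154)₁ DERIVED BY NAME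

Cell `pub-ymgap`, seat `pub-ymgap-dag-n07-e` g23 (FAN-OUT §N07 row s3; LANE OWNER of the K0 road), MODULE 60, INTENT-60 (cell bus 2026-08-28T17:45Z); plan g87 YMPLAN-G87-N07-ASKS
(bus l.41648): «`Nrm` TEXT OF RECORD = (N2′) tree-native … with (N1) DERIVED by n07-w6 (88)» + the lane owner's identifier correction (l.41706: the letter is `gaugeAvgIter`, [3] (78)–(81)).
`--kind definition --supports stmt-QuantumFields-20541 --as helper` (K0⁷; dag-lead KEY MAP v2); count-neutral; ONE `def` + theorems.
[15] = [Balaban1985Variational]; [3] = [Balaban1985Averaging]; [6] = [Balaban1985RegularSpaces]; [I] = [Balaban1987RG1].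

THE PRINT.  [15] p. 300–301 (Sect. F): «Applying a gauge transformation to U_k we get a configuration U′_k such, that U′_k ∈ Ax_k(□̃(k), 1), and U′_k satisfies the generalized axial
gauge conditions on □̃(k)» … (147) «V₁′ satisfies the generalized axial gauge conditions on □̃(k) with a center at the point y» … «Now we apply Theorem 2 of the paper [6] to the pair
of configurations U′_k, 1 … there exists a unique gauge transformation u satisfying the restrictions ū_j = 1 on Λ′_j, and such that (152) … (153)», (154) «Ū₁ʲ(x,x′) = V″(x,x′) for
⟨x,x′⟩ ⊂ Λ′_j».  [3] (78)–(81) p. 30: the averaged gauge function `R̄ʲu`; (84)–(88) p. 31: `R̄ʲu = u·R̄_{0,·}U₁^{(j)}` under the axial gauges, hence the sheared average (88).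

WHAT THIS FILE DECLARES (one definition, never asserted) AND PROVES (by-name bookkeeping; NOTHING of [15]∕[3]∕[6] analysis).
* §1 `NrmOfRecord F N Mc ρ : <MODULE 59's `Nrm` type>` — for the run `(ν, M, g, K, k, s)`, the minimiser `U`, the datum `(j, idx)` (print box `cornerP Mc ρ idx`, side `sideP Mc ρ`,
  level `j`), S3's gauge `u` (HS3NORM: `U^{u} = e^{iη_jA}`, the LANDAU COPY `U₁ := gaugeAct u U`) and its potential `A` (unused by the text): THERE IS a residual `w` of level `j`
  (`w = 1` on `T^{(j)}`, [I] (0.21)) such that `U′ := gaugeAct w U` carries the RADIAL axial tower below `j` ([6] (1.15) on [B5] (1.7)'s contours — dag-n07-w6 `exists_residual_radialTower_record`,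
  unique by `existsUnique_radialTower_in_orbit`) AND, with print's coarse-axial re-gauging of the level-`j` data on the datum's top box `h := axialGauge (M^j U′) (lo j) (hi j)` ((147);
  dag-n09's selection, MODULE 40's letters; `lo j = sqLo … j j − 1`, `hi j = sqHi … j j + 1` the canonical box of MODULE 59's HCHART), the gauge `g := h̄ · w · u⁻¹` FROM THE LANDAU COPY TO
  PRINT's REPRESENTATIVE `U″ = U′^{h̄}` is NORMALISED on every cell site of print's local family: `R̄^{j′}g (y) = 1` for `j′ ≤ j`, `y ∈ Λ′_{j′}(D″)` (`Domains.LamSite`), `D″ :=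
  domainsMeet (cubeDomains … j ·) (domainsOfSeq s.Ω j ·)` — the letter `R̄^{j′} = gaugeAvgIter (loopAvgBlockOp expMeanLogSU)` of n07-e `Node00/ShearedAveragingFlat` ∕ n07-w6
  `Node00/ShearedAveragingRecord` (EXACTLY the hypothesis shape `hsrc ∕ htgt` of the (88) lemmas).
* §2 ★★ `shearedAvgIter_landau_eq_iter_rep` — (154)₁ ∕ (N1) DERIVED, generic in the witness: under the radial tower of `U′ = U^w` below `j`, for a bond `c` of `T^{(j′)}`, `j′ ≤ j`,
  normalised at both ends, `𝒜_{j′}(U₁)(c) = M^{j′}(U″)(c)` — the sheared average of the Landau copy IS the representative's average (n07-w6 `shearedAvgIter_radial_eq_iter_gauge` +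
  `radialTower_gaugeAct_blockLift` + `gaugeAct_gaugeAct`); ★★ `shearedAvgIter_landau_top_eq_dataAxial` — at the top level `𝒜_j(U₁)(c) = (V^h)(c)`, `V = M^j(U′)` = the record's data at
  level `j` in the coarse axial gauge (n07-w6 `shearedAvgIter_radial_eq_dataAxial_of_rep`); ★★★ `NrmOfRecord.shearedAvgIter_eq_iter_rep` ∕ `…_top_eq_dataAxial` — the same read off
  `NrmOfRecord` at bonds whose two ends are cell sites of `D″` (print (154): «for ⟨x,x′⟩, x, x′ ∈ Λ′_j»).
WHO USES IT.  S3 pens prove `NrmOfRecord` per meeting clean datum inside HS3NORM (interior: `hP6` + `Restr129` export, dag-n07-w3 lineage; outward: `GaugedBoundB8′`, N05 (d1)–(d3));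
the chart lane consumes it through §2 to read MODULE 59's `B` as DATA rows ((147)+(160)-I MODULE 40 at the top; (145)∕(151)∕(155) below).  LOCATED (stated, not decided here): bonds of
`BondIdx D″` with one end outside `Λ′` (the tree's inclusive reading (b) of [4] (2.3); lit-balaban ME #35) get NO second-end normalisation from print — §2 is stated for two normalised ends.

HONEST SCOPE.  One definition (a displayed predicate, NEVER asserted) + kernel bookkeeping over LANDED theorems; nothing of Bałaban's analysis is proved; `NrmOfRecord` DISCHARGES NOTHING —
it is the agreed TEXT of MODULE 59's abstract `Nrm`; HS3NORM ∕ HCHART-MEET-NORM ∕ HBUDGET-NORM stay displayed; stub 1-G‴ ∕ K0⁷ ∕ K1⁹ NOT closed; N07 ∕ N05 NOT discharged; counts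
unmoved (typed 28∕28 · discharged 5∕27); one finite 𝕋⁴ programme at fixed ε — the route closes the conditional finite-𝕋⁴ rung `BalabanLadder.UV` ONLY; the YM mass gap (Clay) is NOT
proved by any of this; nothing continuum ∕ ℝ⁴ ∕ OS.  ONE `def`, no `instance`, no `notation`, no `sorry`.

References: [15] (144) p. 300, (147)–(154) pp. 301–302; [3] (78)–(81) p. 30, (84)–(88) p. 31; [6] (1.14)–(1.15) p. 78, (1.29) p. 81, Thm. 2 p. 83; [I] (0.1) p. 251, (0.21) p. 256.
-/

set_option autoImplicit false

noncomputable section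

namespace Summit.QuantumFields.YangMills.BalabanUVNodes.N07NormalisationOfRecord

open Literature.MathematicalPhysics.QuantumFieldTheory.Balaban1983to89
open Literature.MathematicalPhysics.QuantumFieldTheory.Balaban1983to89.Node00
open T4Continuum (T4Family)
open T4AxialGaugeSmallField (axialGauge)
open B12GaugeOrbits021 (IsResidual)
open B15Eq177GaugeInvariance (blockLift)
open B14DomainGeom (Pt)
open B8Eq131Cubes (sqLo sqHi)
open B6SectADomainsV1 (Domains)
open GaugeField (gaugeAct)
open ExpMeanLog (expMeanLogSU)
open Summit.QuantumFields.Balaban3D.Carriers (radialContourData)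
open Summit.QuantumFields.YangMills.BalabanUVNodes.N07RadialAxialTower (radialTower_gaugeAct_blockLift shearedAvgIter_radial_eq_iter_gauge
  shearedAvgIter_radial_eq_dataAxial_of_rep)
open Summit.QuantumFields.YangMills.BalabanUVNodes.N09AxialSelectionExists (iter_gaugeAct_blockLift)

/-! ## §1  The definition -/

/-- **THE NORMALISATION OF RECORD** — print's «there exists a unique gauge transformation `u` satisfying the restrictions `ū_j = 1` on `Λ′_j`» ([15] p. 301) in the tree's letters, as the
text of MODULE 59's abstract `Nrm`: for the datum `(j, idx)` of the grid-cube family `(Mc, ρ)`, the minimiser `U` and S3's gauge `u` (Landau copy `U₁ = U^{u}`), there is a residual `w`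
of level `j` with `U′ = U^{w}` RADIAL-AXIAL below `j` ([6] (1.15)) such that the gauge `g = h̄·w·u⁻¹` from the Landau copy to print's representative `U″ = U′^{h̄}` — `h` the coarse axial
gauge of the level-`j` data `M^j U′` on the datum's top box ((147)) — has `R̄^{j′}g = 1` ([3] (78)–(81)) on every cell site `Λ′_{j′}` (`j′ ≤ j`) of print's local family
`D″ = {□_{j′} ∩ Ω_{j′}}` ((150)).  A displayed predicate, NEVER asserted.
[cite: Balaban1985Variational, (147) p.301, (150)–(152) p.301, (154) p.302; Balaban1985Averaging, (78)–(81) p.30; Balaban1985RegularSpaces, (1.14)–(1.15) p.78, (1.29) p.81; Balaban1987RG1, (0.21) p.256] -/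
def NrmOfRecord (F : T4Family) (N : ℕ) [NeZero N] (Mc ρ : ℕ) :
    ∀ (ν : Stage7Numerics) (M : ℕ) (g : ℕ → ℝ) (K k : ℕ), SeqOfRecord F ν M g K k → GaugeField (F.P K) 0 (SU N) → ℕ → Pt (F.P K).d →
      GaugeTransf (F.P K) 0 (SU N) → (PBond (F.P K) 0 → MatA N) → Prop :=
  fun _ν _M _g K _k s U j idx u _A =>
    ∃ w : GaugeTransf (F.P K) 0 (SU N), IsResidual j w ∧
      (∀ i < j, AxialGauge (radialContourData (F.P K) i (SU N)) (Averaging.iter (avOfRecord F N K) i (gaugeAct w U))) ∧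
      ∀ (hk : j ≤ (F.P K).m + (F.P K).K) (j' : ℕ), j' ≤ j → ∀ y : Site (F.P K) j',
        (domainsMeet (cubeDomains (F.P K) (cornerP (F.P K) Mc ρ idx) (sideP (F.P K) Mc ρ) ρ j hk) (domainsOfSeq s.Ω j hk)).LamSite j' y →
          gaugeAvgIter (loopAvgBlockOp expMeanLogSU)
              (fun x => blockLift j (axialGauge (Averaging.iter (avOfRecord F N K) j (gaugeAct w U))
                  (sqLo (F.P K).L (cornerP (F.P K) Mc ρ idx) ρ j j - 1) (sqHi (F.P K).L (cornerP (F.P K) Mc ρ idx) (sideP (F.P K) Mc ρ) ρ j j + 1)) x *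
                w x * (u x)⁻¹) j' y = 1

/-! ## §2  (154)₁ ∕ (N1) derived by name: the sheared average of the Landau copy is the representative's average; at the top it is the coarse-axial data -/

section Derived

variable (F : T4Family) (N : ℕ) [NeZero N]

/-- The gauge `g = h̄·w·u⁻¹` composed with S3's `u` is `h̄·w`: `(U^{u})^{g} = (U^{w})^{h̄}` (pointwise group algebra). [cite: Balaban1985Variational, (147) p.301 (bookkeeping)] -/
theorem gaugeAct_rep_of_landau (K : ℕ) {j : ℕ} (h : GaugeTransf (F.P K) j (SU N)) (w u : GaugeTransf (F.P K) 0 (SU N)) (U : GaugeField (F.P K) 0 (SU N)) :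
    gaugeAct (fun x => blockLift j h x * w x * (u x)⁻¹) (gaugeAct u U) = gaugeAct (blockLift j h) (gaugeAct w U) := by
  rw [T3UnitLawGaugeInvariance.gaugeAct_gaugeAct, T3UnitLawGaugeInvariance.gaugeAct_gaugeAct]
  congr 1
  funext x
  rw [mul_assoc, inv_mul_cancel, mul_one]

/-- ★★ **(154)₁ ∕ (N1) DERIVED, generic in the witness**: `U′ = U^{w}` radial-axial below `j ≤ m + K`, `h` any coarse gauge of level `j`, `g = h̄·w·u⁻¹`; at a bond `c` of `T^{(j′)}`,
`j′ ≤ j`, with `R̄^{j′}g = 1` at both ends, the SHEARED average of the Landau copy `U₁ = U^{u}` equals the plain average of print's representative: `𝒜_{j′}(U₁)(c) = M^{j′}((U′)^{h̄})(c)`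
(n07-w6 (88) `shearedAvgIter_radial_eq_iter_gauge`, the tower kept by `radialTower_gaugeAct_blockLift`).
[cite: Balaban1985Variational, (154) p.302; Balaban1985Averaging, (88) p.31; Balaban1985RegularSpaces, (1.15) p.78] -/
theorem shearedAvgIter_landau_eq_iter_rep (K : ℕ) {j : ℕ} (hj : j ≤ (F.P K).m + (F.P K).K) {U : GaugeField (F.P K) 0 (SU N)} {w : GaugeTransf (F.P K) 0 (SU N)}
    (hax : ∀ i < j, AxialGauge (radialContourData (F.P K) i (SU N)) (Averaging.iter (avOfRecord F N K) i (gaugeAct w U)))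
    (h : GaugeTransf (F.P K) j (SU N)) (u : GaugeTransf (F.P K) 0 (SU N)) {j' : ℕ} (hj' : j' ≤ j) {c : PBond (F.P K) j'}
    (hsrc : gaugeAvgIter (loopAvgBlockOp expMeanLogSU) (fun x => blockLift j h x * w x * (u x)⁻¹) j' c.src = 1)
    (htgt : gaugeAvgIter (loopAvgBlockOp expMeanLogSU) (fun x => blockLift j h x * w x * (u x)⁻¹) j' c.tgt = 1) :
    shearedAvgIter (avOfRecord F N K) (fun i => radialContourData (F.P K) i (SU N)) (loopAvgBlockOp expMeanLogSU) (gaugeAct u U) j' c =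
      Averaging.iter (avOfRecord F N K) j' (gaugeAct (blockLift j h) (gaugeAct w U)) c := by
  have hj'K : j' ≤ (F.P K).m + (F.P K).K := hj'.trans hj
  have hax' : ∀ i < j', AxialGauge (radialContourData (F.P K) i (SU N))
      (Averaging.iter (avOfRecord F N K) i (gaugeAct (fun x => blockLift j h x * w x * (u x)⁻¹) (gaugeAct u U))) := by
    rw [gaugeAct_rep_of_landau]
    exact fun i hi => radialTower_gaugeAct_blockLift F N K hj h _ hax i (lt_of_lt_of_le hi hj')
  rw [shearedAvgIter_radial_eq_iter_gauge F N K hj'K hax' hsrc htgt, gaugeAct_rep_of_landau]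

/-- ★★ **(154)₁ AT THE TOP LEVEL = THE COARSE-AXIAL DATA** ((147)): with `h := axialGauge (M^j U′) lo hi`, at a bond `c` of `T^{(j)}` normalised at both ends,
`𝒜_j(U₁)(c) = (V^h)(c)`, `V = M^j(U′)` — the record's level-`j` data re-gauged coarse-axially on the box (n07-w6 `shearedAvgIter_radial_eq_dataAxial_of_rep`).
[cite: Balaban1985Variational, (147) p.301, (154) p.302; Balaban1985Averaging, (88) p.31] -/
theorem shearedAvgIter_landau_top_eq_dataAxial (K : ℕ) {j : ℕ} (hj : j ≤ (F.P K).m + (F.P K).K) {U : GaugeField (F.P K) 0 (SU N)} {w : GaugeTransf (F.P K) 0 (SU N)}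
    (hax : ∀ i < j, AxialGauge (radialContourData (F.P K) i (SU N)) (Averaging.iter (avOfRecord F N K) i (gaugeAct w U)))
    (lo hi : Fin (F.P K).d → ℤ) (u : GaugeTransf (F.P K) 0 (SU N)) {c : PBond (F.P K) j}
    (hsrc : gaugeAvgIter (loopAvgBlockOp expMeanLogSU)
      (fun x => blockLift j (axialGauge (Averaging.iter (avOfRecord F N K) j (gaugeAct w U)) lo hi) x * w x * (u x)⁻¹) j c.src = 1)
    (htgt : gaugeAvgIter (loopAvgBlockOp expMeanLogSU)
      (fun x => blockLift j (axialGauge (Averaging.iter (avOfRecord F N K) j (gaugeAct w U)) lo hi) x * w x * (u x)⁻¹) j c.tgt = 1) :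
    shearedAvgIter (avOfRecord F N K) (fun i => radialContourData (F.P K) i (SU N)) (loopAvgBlockOp expMeanLogSU) (gaugeAct u U) j c =
      gaugeAct (axialGauge (Averaging.iter (avOfRecord F N K) j (gaugeAct w U)) lo hi) (Averaging.iter (avOfRecord F N K) j (gaugeAct w U)) c :=
  shearedAvgIter_radial_eq_dataAxial_of_rep F N K hj (gaugeAct w U) hax _ (gaugeAct u U) lo hi (gaugeAct_rep_of_landau F N K _ w u U) hsrc htgt

/-- ★★★ **(154)₁ READ OFF `NrmOfRecord`**: if S3's gauge `u` carries the normalisation of record at the datum `(j, idx)`, then for the witness `w` and EVERY bond `c` of `T^{(j′)}`, `j′ ≤ j`,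
whose two ends are cell sites of print's local family `D″` (print: «⟨x,x′⟩, x, x′ ∈ Λ′_j»), `𝒜_{j′}(U^{u})(c) = M^{j′}((U^{w})^{h̄})(c)` with `h` the coarse axial gauge of the datum's top box.
[cite: Balaban1985Variational, (150)–(154) pp.301–302; Balaban1985Averaging, (88) p.31] -/
theorem NrmOfRecord.exists_rep {F : T4Family} {N : ℕ} [NeZero N] {Mc ρ : ℕ} {ν : Stage7Numerics} {M : ℕ} {g : ℕ → ℝ} {K k : ℕ}
    {s : SeqOfRecord F ν M g K k} {U : GaugeField (F.P K) 0 (SU N)} {j : ℕ} {idx : Pt (F.P K).d} {u : GaugeTransf (F.P K) 0 (SU N)}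
    {A : PBond (F.P K) 0 → MatA N} (hN : NrmOfRecord F N Mc ρ ν M g K k s U j idx u A) (hk : j ≤ (F.P K).m + (F.P K).K) :
    ∃ w : GaugeTransf (F.P K) 0 (SU N), IsResidual j w ∧
      (∀ i < j, AxialGauge (radialContourData (F.P K) i (SU N)) (Averaging.iter (avOfRecord F N K) i (gaugeAct w U))) ∧
      ∀ (j' : ℕ) (_ : j' ≤ j) (c : PBond (F.P K) j'),
        (domainsMeet (cubeDomains (F.P K) (cornerP (F.P K) Mc ρ idx) (sideP (F.P K) Mc ρ) ρ j hk) (domainsOfSeq s.Ω j hk)).LamSite j' c.src →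
        (domainsMeet (cubeDomains (F.P K) (cornerP (F.P K) Mc ρ idx) (sideP (F.P K) Mc ρ) ρ j hk) (domainsOfSeq s.Ω j hk)).LamSite j' c.tgt →
          shearedAvgIter (avOfRecord F N K) (fun i => radialContourData (F.P K) i (SU N)) (loopAvgBlockOp expMeanLogSU) (gaugeAct u U) j' c =
            Averaging.iter (avOfRecord F N K) j'
              (gaugeAct (blockLift j (axialGauge (Averaging.iter (avOfRecord F N K) j (gaugeAct w U))
                (sqLo (F.P K).L (cornerP (F.P K) Mc ρ idx) ρ j j - 1) (sqHi (F.P K).L (cornerP (F.P K) Mc ρ idx) (sideP (F.P K) Mc ρ) ρ j j + 1)))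
                (gaugeAct w U)) c := by
  obtain ⟨w, hres, hax, hnorm⟩ := hN
  exact ⟨w, hres, hax, fun j' hj' c hs ht =>
    shearedAvgIter_landau_eq_iter_rep F N K hk hax _ u hj' (hnorm hk j' hj' c.src hs) (hnorm hk j' hj' c.tgt ht)⟩

/-- ★★★ **THE TOP LEVEL READ OFF `NrmOfRecord`: the Landau copy's sheared `j`-fold averages on print's top cells ARE the coarse-axial DATA** — for bonds `c` of `T^{(j)}` with both ends in
`Λ′_j(D″)`: `𝒜_j(U^{u})(c) = (V^h)(c)`, `V = M^j(U^w) = M^j(U)` (`w` residual), `h` the coarse axial gauge on the datum's top box ((147); the (160)-I rows of MODULE 40 apply to `V^h`).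
[cite: Balaban1985Variational, (147) p.301, (154) p.302, (160) p.303; Balaban1985Averaging, (88) p.31] -/
theorem NrmOfRecord.exists_top_dataAxial {F : T4Family} {N : ℕ} [NeZero N] {Mc ρ : ℕ} {ν : Stage7Numerics} {M : ℕ} {g : ℕ → ℝ} {K k : ℕ}
    {s : SeqOfRecord F ν M g K k} {U : GaugeField (F.P K) 0 (SU N)} {j : ℕ} {idx : Pt (F.P K).d} {u : GaugeTransf (F.P K) 0 (SU N)}
    {A : PBond (F.P K) 0 → MatA N} (hN : NrmOfRecord F N Mc ρ ν M g K k s U j idx u A) (hk : j ≤ (F.P K).m + (F.P K).K) :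
    ∃ w : GaugeTransf (F.P K) 0 (SU N), IsResidual j w ∧
      (∀ i < j, AxialGauge (radialContourData (F.P K) i (SU N)) (Averaging.iter (avOfRecord F N K) i (gaugeAct w U))) ∧
      Averaging.iter (avOfRecord F N K) j (gaugeAct w U) = Averaging.iter (avOfRecord F N K) j U ∧
      ∀ c : PBond (F.P K) j,
        (domainsMeet (cubeDomains (F.P K) (cornerP (F.P K) Mc ρ idx) (sideP (F.P K) Mc ρ) ρ j hk) (domainsOfSeq s.Ω j hk)).LamSite j c.src →
        (domainsMeet (cubeDomains (F.P K) (cornerP (F.P K) Mc ρ idx) (sideP (F.P K) Mc ρ) ρ j hk) (domainsOfSeq s.Ω j hk)).LamSite j c.tgt →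
          shearedAvgIter (avOfRecord F N K) (fun i => radialContourData (F.P K) i (SU N)) (loopAvgBlockOp expMeanLogSU) (gaugeAct u U) j c =
            gaugeAct (axialGauge (Averaging.iter (avOfRecord F N K) j U)
                (sqLo (F.P K).L (cornerP (F.P K) Mc ρ idx) ρ j j - 1) (sqHi (F.P K).L (cornerP (F.P K) Mc ρ idx) (sideP (F.P K) Mc ρ) ρ j j + 1))
              (Averaging.iter (avOfRecord F N K) j U) c := by
  obtain ⟨w, hres, hax, hnorm⟩ := hN
  have hV : Averaging.iter (avOfRecord F N K) j (gaugeAct w U) = Averaging.iter (avOfRecord F N K) j U :=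
    B12GaugeOrbits021.iter_gaugeAct_of_isResidual (avOfRecord F N K) hk hres U
  refine ⟨w, hres, hax, hV, fun c hs ht => ?_⟩
  rw [← hV]
  exact shearedAvgIter_landau_top_eq_dataAxial F N K hk hax _ _ u (hnorm hk j le_rfl c.src hs) (hnorm hk j le_rfl c.tgt ht)

end Derived

end Summit.QuantumFields.YangMills.BalabanUVNodes.N07NormalisationOfRecord

end
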